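/-
Copyright (c) 2026 the pub-hodgecm-mathlib formalisation cell (harness21).  Prover seat hodgecm-mathlib-K2Liu-p03 (g6): Track B «K2-LIT»,
#184♮ = hLiu418 = stmt-HodgeConjecture-24832, road `K2_Liu`, Road I organ (A-int)-fin, A7-reg (GK COCYCLE road), file B1b-2c
(K2Liu-p09 (g5) 2026-09-04T08:33:55Z (L1)(L2): the Siegel character of the transported LEVI letters).
-/
import Summits.HodgeConjecture.HodgeConjecture.Theorems.K2LiuDoubledUTwoTwoLevi                 -- ★ B1a-3: `leviElt`, `leviM`
import Summits.HodgeConjecture.HodgeConjecture.Theorems.K2LiuDoubledUTwoTwoFrameTransport      -- ★ B1b-1: `adapt_matA_frameConj`, `toLocalFour`, `matS_toLocalFour`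
import Summits.HodgeConjecture.HodgeConjecture.Theorems.K2LiuSiegelLeviWeylAlgebra              -- ★ `detDelta_levi`
import HarnessLib

/-!
# Crux `HLiu418`, road `K2_Liu`, organ (A-int)-fin, A7-reg file B1b-2c: THE TRANSPORTED LEVI LETTERS LIE IN `P_Δ(F_v)` AND THEIR SIEGEL CHARACTER
# IS `χ_v(det_Δ)|det_Δ|_v^{s+1} = (∏_w χ_w(det A)_w)·(∏_w ‖(det A)_w‖)^{s+1}`

Cell `hodgecm-mathlib`, crux item hLiu418 = `stmt-HodgeConjecture-24832`; squad K2 ∕ K2Liu; prover K2Liu-p03 (g6).  THEOREMS ONLY (no `def`, no instance,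
no notation, no named-fact hypothesis, no `sorry`); lane `--supports stmt-HodgeConjecture-24832 --as helper`.

Setting of ★ B1b-1∕2a∕2b: `H_v = U(T₂ ⊕ −T₂)(F_v)`, rational frame `Q = e₂∘(1 D; 1 −D)` (`D Dinv = 1`), `φ := frameConj Q ∘ toLocalFour : U(J₄)(E ⊗ F_v) → H_v`.
* §1 GENERIC BLOCK-DIAGONAL LETTER: if the `Fin 2 ⊕ Fin 2`-blocked matrix of `g ∈ U(J₄)` is `diag(A′, D′)` then `adapt (matA (φ g)) = diag(A′, D_v D′ Dinv_v)`
  (★ `adapt_matA_frameConj`), so `φ g ∈ P_Δ(F_v)` with `B = 0` (a LEVI element), `det_Δ(φ g)_w = (det A′)_w`, `|det_Δ(φ g)|_v = ∏_w ‖(det A′)_w‖`,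
  `χ_v(det_Δ(φ g)) = ∏_w χ_w((det A′)_w)` and **`localSiegelCharacter χ_v s (φ g) = (∏_w χ_w(u_w)) · (∏_w ‖(det A′)_w‖)^{s+1}`** (`u` = the unit `det A′`).
* §2 THE LEVI LETTERS (K2Liu-p09's (L1)(L2)): `leviElt A` (`A′ = A`, `u = det A`) and `torusElt a b` (`A′ = diag(a,b)`, `u = a b`) — the torus characters of the
  rank-one steps; the Weyl letter `weylOne`, the root letter `uMinus z` and the continuity of the letters (L3) are in the sequel file B1b-2d
  `K2LiuDoubledUTwoTwoLetterTransport`.  These are the letter facts under which the step operators `A₂ A₁ A₂` of ★ B1a-2 `weylSiegel_mul_nSiegel` become rank-one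
  intertwining integrals with explicit torus characters (file B4 `K2LiuSiegelIntertwiningCocycle`, K2Liu-p09).
HONEST LABEL.  Count-neutral helper: `HC_CM` is proved only modulo the 7 printed citations (2 remaining named inputs: hLiu418 = `stmt-HodgeConjecture-24832`,
h413 = `stmt-HodgeConjecture-24833`) until rung 0 closes.

## References
* [HarrisKudlaSweet1996] M. Harris, S. Kudla, W. J. Sweet, J. AMS 9 (1996): §1 (1.11)–(1.12), (1.15) (`P_Δ`, its Levi, `χ(det_Δ)|det_Δ|^{s+n/2}`).
* [Kudla1994] S. S. Kudla, Israel J. Math. 87 (1994): §3 (`x(p) = det_Δ`).   * [Casselman1980] W. Casselman, Compositio 40: §3 (rank-one reduction, torus characters).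
-/

set_option autoImplicit false
set_option linter.dupNamespace false -- the mandated namespace repeats `HodgeConjecture.HodgeConjecture`

noncomputable section

open NumberField IsDedekindDomain Matrix
open Literature.NumberTheory.Automorphic Literature.NumberTheory.Automorphic.UnitaryGroup
open Literature.NumberTheory.GelbartRogawski1991.AdaptedBlocks
open Literature.NumberTheory.GelbartRogawski1991.UnitaryDualPair.LocalSplitting
open Literature.NumberTheory.K2Lit.LocalSiegelDoubled
open Summit.HodgeConjecture.HodgeConjecture.Cruxes.HLiu418.K2LiuLocalSiegelIwasawa
open Summit.HodgeConjecture.HodgeConjecture.Cruxes.HLiu418.K2LiuDoubledUTwoTwoBorelFrame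
open Summit.HodgeConjecture.HodgeConjecture.Cruxes.HLiu418.K2LiuDoubledUTwoTwoWeylCocycle
open Summit.HodgeConjecture.HodgeConjecture.Cruxes.HLiu418.K2LiuDoubledUTwoTwoLevi
open Summit.HodgeConjecture.HodgeConjecture.Cruxes.HLiu418.K2LiuDoubledUTwoTwoFrameTransport
open Summit.HodgeConjecture.HodgeConjecture.Cruxes.HLiu418.K2LiuSiegelLeviWeylAlgebra

namespace Summit.HodgeConjecture.HodgeConjecture.Cruxes.HLiu418.K2LiuDoubledUTwoTwoLeviTransport

variable (F : Type) [Field F] [NumberField F] (E : Type) [Field E] [NumberField E] [Algebra F E]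
  [Algebra.IsQuadraticExtension F E] (c : E ≃ₐ[F] E)
  {δ : E} (hcδ : c δ = -δ) (hδ : δ ≠ 0) {d : F} (hd : δ * δ = algebraMap F E d) (v : HeightOneSpectrum (𝓞 F))
  {T₂ : Matrix (Fin 2) (Fin 2) F} (hT₂ : T₂.IsSymm) {J₂D : Matrix (Fin (2 + 2)) (Fin (2 + 2)) E} (hJ₂D : J₂D = (gramD F 2 T₂).map (algebraMap F E))
  (D Dinv : Matrix (Fin 2) (Fin 2) F) (hDD : D * Dinv = 1) (Q : GL (Fin (2 + 2)) F)
  (hQm : (Q : Matrix (Fin (2 + 2)) (Fin (2 + 2)) F) = Matrix.reindex (e₂ 2) (e₂ 2) (Matrix.fromBlocks 1 D 1 (-D)))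
  (hQ : (Q : Matrix (Fin (2 + 2)) (Fin (2 + 2)) F)ᵀ * gramD F 2 T₂ * (Q : Matrix (Fin (2 + 2)) (Fin (2 + 2)) F) = (StdForm.antidiagonal (2 + 2)).over F)

/-! ## §1 A generic block-diagonal letter of `U(J₄)(E ⊗ F_v)` transported to `H_v` -/

section Generic

variable (g : unitaryGroupOfForm (UnitaryGroup.conjLocal E c v) ((StdForm.antidiagonal 4).over (UnitaryGroup.LocalRing E v)))
  (A' D' : Matrix (Fin 2) (Fin 2) (UnitaryGroup.LocalRing E v))
  (hg : Matrix.reindex (e₂ 2).symm (e₂ 2).symm (g : GL (Fin 4) (UnitaryGroup.LocalRing E v)).1 = Matrix.fromBlocks A' 0 0 D')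

omit [Algebra.IsQuadraticExtension F E] in
include hJ₂D hDD hQm hg in
/-- **a block-diagonal letter in the adapted frame**: if the blocked matrix of `g` is `diag(A′, D′)` then `adapt (matA (Q g Q⁻¹)) = diag(A′, D_v D′ Dinv_v)`.
[cite: HarrisKudlaSweet1996, §1 (1.11)–(1.12)] -/
theorem adapt_matA_frameConj_of_blocks :
    adapt (matA F E c v 2 (FrameTransport.frameConj F E c v (2 + 2) hJ₂D (antidiagonal_over_eq_map F E 2) Q hQ (toLocalFour F E c v g))) =
      Matrix.fromBlocks A' 0 0 (D.map ((UnitaryGroup.toLocalRing E v).comp (algebraMap F (v.adicCompletion F))) * D' *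
        Dinv.map ((UnitaryGroup.toLocalRing E v).comp (algebraMap F (v.adicCompletion F)))) := by
  rw [adapt_matA_frameConj F E c v 2 hJ₂D D Dinv hDD Q hQm hQ, matS_toLocalFour, hg, Matrix.fromBlocks_multiply, Matrix.fromBlocks_multiply]
  simp only [Matrix.mul_one, Matrix.one_mul, Matrix.mul_zero, Matrix.zero_mul, add_zero, zero_add]

omit [Algebra.IsQuadraticExtension F E] in
include hJ₂D hDD hQm hg in
/-- the four blocks of a transported block-diagonal letter: `A = A′`, `B = 0`, `C = 0`, `D = D_v D′ Dinv_v`. [cite: HarrisKudlaSweet1996, §1 (1.11)–(1.12)] -/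
theorem blocks_matA_frameConj_of_blocks :
    blkA (matA F E c v 2 (FrameTransport.frameConj F E c v (2 + 2) hJ₂D (antidiagonal_over_eq_map F E 2) Q hQ (toLocalFour F E c v g))) = A' ∧
      blkB (matA F E c v 2 (FrameTransport.frameConj F E c v (2 + 2) hJ₂D (antidiagonal_over_eq_map F E 2) Q hQ (toLocalFour F E c v g))) = 0 ∧
      blkC (matA F E c v 2 (FrameTransport.frameConj F E c v (2 + 2) hJ₂D (antidiagonal_over_eq_map F E 2) Q hQ (toLocalFour F E c v g))) = 0 ∧
      blkD (matA F E c v 2 (FrameTransport.frameConj F E c v (2 + 2) hJ₂D (antidiagonal_over_eq_map F E 2) Q hQ (toLocalFour F E c v g))) =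
        D.map ((UnitaryGroup.toLocalRing E v).comp (algebraMap F (v.adicCompletion F))) * D' *
          Dinv.map ((UnitaryGroup.toLocalRing E v).comp (algebraMap F (v.adicCompletion F))) := by
  have h := adapt_matA_frameConj_of_blocks F E c v hJ₂D D Dinv hDD Q hQm hQ g A' D' hg
  rw [adapt_eq] at h
  obtain ⟨h1, h2, h3, h4⟩ := Matrix.fromBlocks_inj.1 h
  exact ⟨h1, h2, h3, h4⟩

include hJ₂D hDD hQm hg in
/-- **(L1, generic) a transported block-diagonal letter lies in `P_Δ(F_v)`** (`C = 0`). [cite: HarrisKudlaSweet1996, §1 (1.11)] [cite: Kudla1994, §3] -/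
theorem isSiegelDelta_frameConj_of_blocks :
    IsSiegelDelta F E c hcδ hδ hd v 2 hT₂ hJ₂D (FrameTransport.frameConj F E c v (2 + 2) hJ₂D (antidiagonal_over_eq_map F E 2) Q hQ (toLocalFour F E c v g)) := by
  rw [isSiegelDelta_iff_blkC_eq_zero]
  exact (blocks_matA_frameConj_of_blocks F E c v hJ₂D D Dinv hDD Q hQm hQ g A' D' hg).2.2.1

omit [Algebra.IsQuadraticExtension F E] in
include hJ₂D hDD hQm hg in
/-- **`det_Δ(Q g Q⁻¹)_w = (det A′)_w`** at every `w ∣ v`. [cite: Kudla1994, §3] [cite: HarrisKudlaSweet1996, §1 (1.15)] -/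
theorem detDelta_frameConj_of_blocks (w : PlacesOver E v) :
    detDelta F E c v 2 w (FrameTransport.frameConj F E c v (2 + 2) hJ₂D (antidiagonal_over_eq_map F E 2) Q hQ (toLocalFour F E c v g)) = A'.det w := by
  obtain ⟨hA, -, hC, -⟩ := blocks_matA_frameConj_of_blocks F E c v hJ₂D D Dinv hDD Q hQm hQ g A' D' hg
  rw [detDelta_levi F E c v 2 hC w, hA]

omit [Algebra.IsQuadraticExtension F E] in
include hJ₂D hDD hQm hg in
/-- **`|det_Δ(Q g Q⁻¹)|_v = ∏_w ‖(det A′)_w‖`**. [cite: HarrisKudlaSweet1996, §1 (1.15)] -/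
theorem absDetDelta_frameConj_of_blocks :
    absDetDelta F E c v 2 (FrameTransport.frameConj F E c v (2 + 2) hJ₂D (antidiagonal_over_eq_map F E 2) Q hQ (toLocalFour F E c v g)) =
      ∏ w : PlacesOver E v, ‖A'.det w‖ :=
  Finset.prod_congr rfl fun w _ => by rw [detDelta_frameConj_of_blocks F E c v hJ₂D D Dinv hDD Q hQm hQ g A' D' hg w]

omit [Algebra.IsQuadraticExtension F E] in
include hJ₂D hDD hQm hg in
/-- **`χ_v(det_Δ(Q g Q⁻¹)) = ∏_w χ_w(u_w)`** when `det A′ = u` is a unit of `E ⊗ F_v = ∏_w E_w` (`u_w` its `w`-component). [cite: HarrisKudlaSweet1996, §1 (1.15)] -/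
theorem chiDet_frameConj_of_blocks (χv : ∀ w : PlacesOver E v, (w.1.adicCompletion E)ˣ →* ℂˣ) (u : (UnitaryGroup.LocalRing E v)ˣ)
    (hu : (u : UnitaryGroup.LocalRing E v) = A'.det) :
    chiDet F E c v 2 χv (FrameTransport.frameConj F E c v (2 + 2) hJ₂D (antidiagonal_over_eq_map F E 2) Q hQ (toLocalFour F E c v g)) =
      ∏ w : PlacesOver E v, χv w (Units.map (Pi.evalMonoidHom (fun w : PlacesOver E v => w.1.adicCompletion E) w : UnitaryGroup.LocalRing E v →* _) u) := by
  classical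
  unfold chiDet
  refine Finset.prod_congr rfl fun w _ => ?_
  have hdet := detDelta_frameConj_of_blocks F E c v hJ₂D D Dinv hDD Q hQm hQ g A' D' hg w
  have hunit : IsUnit (detDelta F E c v 2 w (FrameTransport.frameConj F E c v (2 + 2) hJ₂D (antidiagonal_over_eq_map F E 2) Q hQ (toLocalFour F E c v g))) := by
    rw [hdet, ← hu]
    exact (Units.map (Pi.evalMonoidHom (fun w : PlacesOver E v => w.1.adicCompletion E) w : UnitaryGroup.LocalRing E v →* _) u).isUnit
  rw [dif_pos hunit]
  congr 1
  exact Units.ext (by rw [IsUnit.unit_spec, hdet, Units.coe_map, ← hu]; rfl)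

omit [Algebra.IsQuadraticExtension F E] in
include hJ₂D hDD hQm hg in
/-- **(L2, generic) the inducing character on a transported block-diagonal letter**:
`χ_v(det_Δ)|det_Δ|_v^{s+n/2}(Q g Q⁻¹) = (∏_w χ_w(u_w)) · (∏_w ‖(det A′)_w‖)^{s+1}` (`n = 2`). [cite: HarrisKudlaSweet1996, §1 (1.15)] [cite: Casselman1980, §3] -/
theorem localSiegelCharacter_frameConj_of_blocks (χv : ∀ w : PlacesOver E v, (w.1.adicCompletion E)ˣ →* ℂˣ) (s : ℂ) (u : (UnitaryGroup.LocalRing E v)ˣ)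
    (hu : (u : UnitaryGroup.LocalRing E v) = A'.det) :
    localSiegelCharacter F E c v 2 χv s (FrameTransport.frameConj F E c v (2 + 2) hJ₂D (antidiagonal_over_eq_map F E 2) Q hQ (toLocalFour F E c v g)) =
      (∏ w : PlacesOver E v, ((χv w (Units.map (Pi.evalMonoidHom (fun w : PlacesOver E v => w.1.adicCompletion E) w : UnitaryGroup.LocalRing E v →* _) u) : ℂˣ) : ℂ)) *
        (((∏ w : PlacesOver E v, ‖A'.det w‖ : ℝ) : ℂ) ^ (s + 1)) := by
  unfold localSiegelCharacter
  rw [chiDet_frameConj_of_blocks F E c v hJ₂D D Dinv hDD Q hQm hQ g A' D' hg χv u hu, absDetDelta_frameConj_of_blocks F E c v hJ₂D D Dinv hDD Q hQm hQ g A' D' hg,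
    Units.coe_prod]
  congr 2
  push_cast
  ring

end Generic

/-! ## §2 The Levi letters `leviElt A` and `torusElt a b` -/

/-- blocked matrix of `m(A)`: `diag(A, J σ(A⁻¹)ᵀ J)`. [cite: HarrisKudlaSweet1996, §1 (1.11)] -/
theorem reindex_leviElt (A : GL (Fin 2) (UnitaryGroup.LocalRing E v)) :
    Matrix.reindex (e₂ 2).symm (e₂ 2).symm
        ((leviElt (UnitaryGroup.LocalRing E v) (UnitaryGroup.conjLocal E c v) (UnitaryGroup.conjLocal_conjLocal c v hcδ hδ) A :
          unitaryGroupOfForm _ _) : GL (Fin 4) (UnitaryGroup.LocalRing E v)).1 =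
      Matrix.fromBlocks (A.1 : Matrix (Fin 2) (Fin 2) (UnitaryGroup.LocalRing E v)) 0 0
        !![UnitaryGroup.conjLocal E c v ((A.1 : Matrix (Fin 2) (Fin 2) (UnitaryGroup.LocalRing E v))⁻¹ 1 1),
            UnitaryGroup.conjLocal E c v ((A.1 : Matrix (Fin 2) (Fin 2) (UnitaryGroup.LocalRing E v))⁻¹ 0 1);
           UnitaryGroup.conjLocal E c v ((A.1 : Matrix (Fin 2) (Fin 2) (UnitaryGroup.LocalRing E v))⁻¹ 1 0),
            UnitaryGroup.conjLocal E c v ((A.1 : Matrix (Fin 2) (Fin 2) (UnitaryGroup.LocalRing E v))⁻¹ 0 0)] := by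
  rw [coe_leviElt]
  ext i j
  rcases i with i | i <;> rcases j with j | j <;> fin_cases i <;> fin_cases j <;> rfl

/-- blocked matrix of `t(a,b)`: `diag(diag(a,b), diag(σb⁻¹, σa⁻¹))`. [cite: Casselman1980, §3] -/
theorem reindex_torusElt (a b : (UnitaryGroup.LocalRing E v)ˣ) :
    Matrix.reindex (e₂ 2).symm (e₂ 2).symm
        ((torusElt (UnitaryGroup.LocalRing E v) (UnitaryGroup.conjLocal E c v) (UnitaryGroup.conjLocal_conjLocal c v hcδ hδ) a b :
          unitaryGroupOfForm _ _) : GL (Fin 4) (UnitaryGroup.LocalRing E v)).1 =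
      Matrix.fromBlocks !![(a : UnitaryGroup.LocalRing E v), 0; 0, (b : UnitaryGroup.LocalRing E v)] 0 0
        !![UnitaryGroup.conjLocal E c v ((b⁻¹ : (UnitaryGroup.LocalRing E v)ˣ) : UnitaryGroup.LocalRing E v), 0;
           0, UnitaryGroup.conjLocal E c v ((a⁻¹ : (UnitaryGroup.LocalRing E v)ˣ) : UnitaryGroup.LocalRing E v)] := by
  rw [coe_torusElt]
  ext i j
  rcases i with i | i <;> rcases j with j | j <;> fin_cases i <;> fin_cases j <;> rfl

include hJ₂D hDD hQm in
/-- **(L1) `Q m(A) Q⁻¹ ∈ P_Δ(F_v)`** for every `A ∈ GL₂(E ⊗ F_v)`. [cite: HarrisKudlaSweet1996, §1 (1.11)] -/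
theorem isSiegelDelta_frameConj_leviElt (A : GL (Fin 2) (UnitaryGroup.LocalRing E v)) :
    IsSiegelDelta F E c hcδ hδ hd v 2 hT₂ hJ₂D (FrameTransport.frameConj F E c v (2 + 2) hJ₂D (antidiagonal_over_eq_map F E 2) Q hQ
      (toLocalFour F E c v (leviElt (UnitaryGroup.LocalRing E v) (UnitaryGroup.conjLocal E c v) (UnitaryGroup.conjLocal_conjLocal c v hcδ hδ) A))) :=
  isSiegelDelta_frameConj_of_blocks F E c hcδ hδ hd v hT₂ hJ₂D D Dinv hDD Q hQm hQ _ _ _ (reindex_leviElt F E c hcδ hδ v A)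

include hJ₂D hDD hQm in
/-- `Q m(A) Q⁻¹` is a LEVI element (`B = 0`, `C = 0`) with `Δ`-block `A`. [cite: HarrisKudlaSweet1996, §1 (1.11)] -/
theorem blocks_matA_frameConj_leviElt (A : GL (Fin 2) (UnitaryGroup.LocalRing E v)) :
    blkA (matA F E c v 2 (FrameTransport.frameConj F E c v (2 + 2) hJ₂D (antidiagonal_over_eq_map F E 2) Q hQ
        (toLocalFour F E c v (leviElt (UnitaryGroup.LocalRing E v) (UnitaryGroup.conjLocal E c v) (UnitaryGroup.conjLocal_conjLocal c v hcδ hδ) A)))) =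
        (A.1 : Matrix (Fin 2) (Fin 2) (UnitaryGroup.LocalRing E v)) ∧
      blkB (matA F E c v 2 (FrameTransport.frameConj F E c v (2 + 2) hJ₂D (antidiagonal_over_eq_map F E 2) Q hQ
        (toLocalFour F E c v (leviElt (UnitaryGroup.LocalRing E v) (UnitaryGroup.conjLocal E c v) (UnitaryGroup.conjLocal_conjLocal c v hcδ hδ) A)))) = 0 ∧
      blkC (matA F E c v 2 (FrameTransport.frameConj F E c v (2 + 2) hJ₂D (antidiagonal_over_eq_map F E 2) Q hQ
        (toLocalFour F E c v (leviElt (UnitaryGroup.LocalRing E v) (UnitaryGroup.conjLocal E c v) (UnitaryGroup.conjLocal_conjLocal c v hcδ hδ) A)))) = 0 := by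
  obtain ⟨h1, h2, h3, -⟩ := blocks_matA_frameConj_of_blocks F E c v hJ₂D D Dinv hDD Q hQm hQ _ _ _ (reindex_leviElt F E c hcδ hδ v A)
  exact ⟨h1, h2, h3⟩

include hJ₂D hDD hQm in
/-- **`det_Δ(Q m(A) Q⁻¹)_w = (det A)_w`**. [cite: Kudla1994, §3] -/
theorem detDelta_frameConj_leviElt (A : GL (Fin 2) (UnitaryGroup.LocalRing E v)) (w : PlacesOver E v) :
    detDelta F E c v 2 w (FrameTransport.frameConj F E c v (2 + 2) hJ₂D (antidiagonal_over_eq_map F E 2) Q hQ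
        (toLocalFour F E c v (leviElt (UnitaryGroup.LocalRing E v) (UnitaryGroup.conjLocal E c v) (UnitaryGroup.conjLocal_conjLocal c v hcδ hδ) A))) =
      (A.1 : Matrix (Fin 2) (Fin 2) (UnitaryGroup.LocalRing E v)).det w :=
  detDelta_frameConj_of_blocks F E c v hJ₂D D Dinv hDD Q hQm hQ _ _ _ (reindex_leviElt F E c hcδ hδ v A) w

include hJ₂D hDD hQm in
/-- **`|det_Δ(Q m(A) Q⁻¹)|_v = ∏_w ‖(det A)_w‖`**. [cite: HarrisKudlaSweet1996, §1 (1.15)] -/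
theorem absDetDelta_frameConj_leviElt (A : GL (Fin 2) (UnitaryGroup.LocalRing E v)) :
    absDetDelta F E c v 2 (FrameTransport.frameConj F E c v (2 + 2) hJ₂D (antidiagonal_over_eq_map F E 2) Q hQ
        (toLocalFour F E c v (leviElt (UnitaryGroup.LocalRing E v) (UnitaryGroup.conjLocal E c v) (UnitaryGroup.conjLocal_conjLocal c v hcδ hδ) A))) =
      ∏ w : PlacesOver E v, ‖(A.1 : Matrix (Fin 2) (Fin 2) (UnitaryGroup.LocalRing E v)).det w‖ :=
  absDetDelta_frameConj_of_blocks F E c v hJ₂D D Dinv hDD Q hQm hQ _ _ _ (reindex_leviElt F E c hcδ hδ v A)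

include hJ₂D hDD hQm in
/-- **`χ_v(det_Δ(Q m(A) Q⁻¹)) = ∏_w χ_w((det A)_w)`** (`det A ∈ (E ⊗ F_v)ˣ`, `w`-components via `Pi.evalMonoidHom`). [cite: HarrisKudlaSweet1996, §1 (1.15)] -/
theorem chiDet_frameConj_leviElt (χv : ∀ w : PlacesOver E v, (w.1.adicCompletion E)ˣ →* ℂˣ) (A : GL (Fin 2) (UnitaryGroup.LocalRing E v)) :
    chiDet F E c v 2 χv (FrameTransport.frameConj F E c v (2 + 2) hJ₂D (antidiagonal_over_eq_map F E 2) Q hQ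
        (toLocalFour F E c v (leviElt (UnitaryGroup.LocalRing E v) (UnitaryGroup.conjLocal E c v) (UnitaryGroup.conjLocal_conjLocal c v hcδ hδ) A))) =
      ∏ w : PlacesOver E v, χv w (Units.map (Pi.evalMonoidHom (fun w : PlacesOver E v => w.1.adicCompletion E) w : UnitaryGroup.LocalRing E v →* _)
        (Matrix.GeneralLinearGroup.det A)) :=
  chiDet_frameConj_of_blocks F E c v hJ₂D D Dinv hDD Q hQm hQ _ _ _ (reindex_leviElt F E c hcδ hδ v A) χv _ (Matrix.GeneralLinearGroup.val_det_apply A)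

include hJ₂D hDD hQm in
/-- **(L2) `χ_v(det_Δ)|det_Δ|_v^{s+1}(Q m(A) Q⁻¹) = (∏_w χ_w((det A)_w)) · (∏_w ‖(det A)_w‖)^{s+1}`**. [cite: HarrisKudlaSweet1996, §1 (1.15)] [cite: Casselman1980, §3] -/
theorem localSiegelCharacter_frameConj_leviElt (χv : ∀ w : PlacesOver E v, (w.1.adicCompletion E)ˣ →* ℂˣ) (s : ℂ) (A : GL (Fin 2) (UnitaryGroup.LocalRing E v)) :
    localSiegelCharacter F E c v 2 χv s (FrameTransport.frameConj F E c v (2 + 2) hJ₂D (antidiagonal_over_eq_map F E 2) Q hQ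
        (toLocalFour F E c v (leviElt (UnitaryGroup.LocalRing E v) (UnitaryGroup.conjLocal E c v) (UnitaryGroup.conjLocal_conjLocal c v hcδ hδ) A))) =
      (∏ w : PlacesOver E v, ((χv w (Units.map (Pi.evalMonoidHom (fun w : PlacesOver E v => w.1.adicCompletion E) w : UnitaryGroup.LocalRing E v →* _)
          (Matrix.GeneralLinearGroup.det A)) : ℂˣ) : ℂ)) *
        (((∏ w : PlacesOver E v, ‖(A.1 : Matrix (Fin 2) (Fin 2) (UnitaryGroup.LocalRing E v)).det w‖ : ℝ) : ℂ) ^ (s + 1)) :=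
  localSiegelCharacter_frameConj_of_blocks F E c v hJ₂D D Dinv hDD Q hQm hQ _ _ _ (reindex_leviElt F E c hcδ hδ v A) χv s _ (Matrix.GeneralLinearGroup.val_det_apply A)

omit [NumberField F] [Algebra.IsQuadraticExtension F E] in
/-- `det diag(a,b) = a b`. [folklore] -/
theorem det_diagTwo (a b : (UnitaryGroup.LocalRing E v)ˣ) :
    ((a * b : (UnitaryGroup.LocalRing E v)ˣ) : UnitaryGroup.LocalRing E v) = (!![(a : UnitaryGroup.LocalRing E v), 0; 0, (b : UnitaryGroup.LocalRing E v)]).det := by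
  rw [Matrix.det_fin_two_of, Units.val_mul]; ring

include hJ₂D hDD hQm in
/-- **(L1) `Q t(a,b) Q⁻¹ ∈ P_Δ(F_v)`**. [cite: Casselman1980, §3] -/
theorem isSiegelDelta_frameConj_torusElt (a b : (UnitaryGroup.LocalRing E v)ˣ) :
    IsSiegelDelta F E c hcδ hδ hd v 2 hT₂ hJ₂D (FrameTransport.frameConj F E c v (2 + 2) hJ₂D (antidiagonal_over_eq_map F E 2) Q hQ
      (toLocalFour F E c v (torusElt (UnitaryGroup.LocalRing E v) (UnitaryGroup.conjLocal E c v) (UnitaryGroup.conjLocal_conjLocal c v hcδ hδ) a b))) :=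
  isSiegelDelta_frameConj_of_blocks F E c hcδ hδ hd v hT₂ hJ₂D D Dinv hDD Q hQm hQ _ _ _ (reindex_torusElt F E c hcδ hδ v a b)

include hJ₂D hDD hQm in
/-- `Q t(a,b) Q⁻¹` is a Levi element with `Δ`-block `diag(a,b)`. [cite: Casselman1980, §3] -/
theorem blocks_matA_frameConj_torusElt (a b : (UnitaryGroup.LocalRing E v)ˣ) :
    blkA (matA F E c v 2 (FrameTransport.frameConj F E c v (2 + 2) hJ₂D (antidiagonal_over_eq_map F E 2) Q hQ
        (toLocalFour F E c v (torusElt (UnitaryGroup.LocalRing E v) (UnitaryGroup.conjLocal E c v) (UnitaryGroup.conjLocal_conjLocal c v hcδ hδ) a b)))) =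
        !![(a : UnitaryGroup.LocalRing E v), 0; 0, (b : UnitaryGroup.LocalRing E v)] ∧
      blkB (matA F E c v 2 (FrameTransport.frameConj F E c v (2 + 2) hJ₂D (antidiagonal_over_eq_map F E 2) Q hQ
        (toLocalFour F E c v (torusElt (UnitaryGroup.LocalRing E v) (UnitaryGroup.conjLocal E c v) (UnitaryGroup.conjLocal_conjLocal c v hcδ hδ) a b)))) = 0 ∧
      blkC (matA F E c v 2 (FrameTransport.frameConj F E c v (2 + 2) hJ₂D (antidiagonal_over_eq_map F E 2) Q hQ
        (toLocalFour F E c v (torusElt (UnitaryGroup.LocalRing E v) (UnitaryGroup.conjLocal E c v) (UnitaryGroup.conjLocal_conjLocal c v hcδ hδ) a b)))) = 0 := by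
  obtain ⟨h1, h2, h3, -⟩ := blocks_matA_frameConj_of_blocks F E c v hJ₂D D Dinv hDD Q hQm hQ _ _ _ (reindex_torusElt F E c hcδ hδ v a b)
  exact ⟨h1, h2, h3⟩

include hJ₂D hDD hQm in
/-- **`det_Δ(Q t(a,b) Q⁻¹)_w = (a b)_w`**. [cite: Casselman1980, §3] -/
theorem detDelta_frameConj_torusElt (a b : (UnitaryGroup.LocalRing E v)ˣ) (w : PlacesOver E v) :
    detDelta F E c v 2 w (FrameTransport.frameConj F E c v (2 + 2) hJ₂D (antidiagonal_over_eq_map F E 2) Q hQ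
        (toLocalFour F E c v (torusElt (UnitaryGroup.LocalRing E v) (UnitaryGroup.conjLocal E c v) (UnitaryGroup.conjLocal_conjLocal c v hcδ hδ) a b))) =
      (a : UnitaryGroup.LocalRing E v) w * (b : UnitaryGroup.LocalRing E v) w := by
  rw [detDelta_frameConj_of_blocks F E c v hJ₂D D Dinv hDD Q hQm hQ _ _ _ (reindex_torusElt F E c hcδ hδ v a b) w, ← det_diagTwo, Units.val_mul]; rfl

include hJ₂D hDD hQm in
/-- **`|det_Δ(Q t(a,b) Q⁻¹)|_v = ∏_w ‖a_w b_w‖`**. [cite: Casselman1980, §3] -/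
theorem absDetDelta_frameConj_torusElt (a b : (UnitaryGroup.LocalRing E v)ˣ) :
    absDetDelta F E c v 2 (FrameTransport.frameConj F E c v (2 + 2) hJ₂D (antidiagonal_over_eq_map F E 2) Q hQ
        (toLocalFour F E c v (torusElt (UnitaryGroup.LocalRing E v) (UnitaryGroup.conjLocal E c v) (UnitaryGroup.conjLocal_conjLocal c v hcδ hδ) a b))) =
      ∏ w : PlacesOver E v, ‖(a : UnitaryGroup.LocalRing E v) w * (b : UnitaryGroup.LocalRing E v) w‖ :=
  Finset.prod_congr rfl fun w _ => by rw [detDelta_frameConj_torusElt F E c hcδ hδ v hJ₂D D Dinv hDD Q hQm hQ a b w]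

include hJ₂D hDD hQm in
/-- **`χ_v(det_Δ(Q t(a,b) Q⁻¹)) = ∏_w χ_w((a b)_w)`**. [cite: Casselman1980, §3] [cite: HarrisKudlaSweet1996, §1 (1.15)] -/
theorem chiDet_frameConj_torusElt (χv : ∀ w : PlacesOver E v, (w.1.adicCompletion E)ˣ →* ℂˣ) (a b : (UnitaryGroup.LocalRing E v)ˣ) :
    chiDet F E c v 2 χv (FrameTransport.frameConj F E c v (2 + 2) hJ₂D (antidiagonal_over_eq_map F E 2) Q hQ
        (toLocalFour F E c v (torusElt (UnitaryGroup.LocalRing E v) (UnitaryGroup.conjLocal E c v) (UnitaryGroup.conjLocal_conjLocal c v hcδ hδ) a b))) =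
      ∏ w : PlacesOver E v, χv w (Units.map (Pi.evalMonoidHom (fun w : PlacesOver E v => w.1.adicCompletion E) w : UnitaryGroup.LocalRing E v →* _) (a * b)) :=
  chiDet_frameConj_of_blocks F E c v hJ₂D D Dinv hDD Q hQm hQ _ _ _ (reindex_torusElt F E c hcδ hδ v a b) χv _ (det_diagTwo F E v a b)

include hJ₂D hDD hQm in
/-- **(L2) `χ_v(det_Δ)|det_Δ|_v^{s+1}(Q t(a,b) Q⁻¹) = (∏_w χ_w((a b)_w)) · (∏_w ‖a_w b_w‖)^{s+1}`** — the torus character of the rank-one steps.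
[cite: Casselman1980, §3] [cite: HarrisKudlaSweet1996, §1 (1.15)] -/
theorem localSiegelCharacter_frameConj_torusElt (χv : ∀ w : PlacesOver E v, (w.1.adicCompletion E)ˣ →* ℂˣ) (s : ℂ) (a b : (UnitaryGroup.LocalRing E v)ˣ) :
    localSiegelCharacter F E c v 2 χv s (FrameTransport.frameConj F E c v (2 + 2) hJ₂D (antidiagonal_over_eq_map F E 2) Q hQ
        (toLocalFour F E c v (torusElt (UnitaryGroup.LocalRing E v) (UnitaryGroup.conjLocal E c v) (UnitaryGroup.conjLocal_conjLocal c v hcδ hδ) a b))) =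
      (∏ w : PlacesOver E v, ((χv w (Units.map (Pi.evalMonoidHom (fun w : PlacesOver E v => w.1.adicCompletion E) w : UnitaryGroup.LocalRing E v →* _)
          (a * b)) : ℂˣ) : ℂ)) *
        (((∏ w : PlacesOver E v, ‖(a : UnitaryGroup.LocalRing E v) w * (b : UnitaryGroup.LocalRing E v) w‖ : ℝ) : ℂ) ^ (s + 1)) := by
  rw [localSiegelCharacter_frameConj_of_blocks F E c v hJ₂D D Dinv hDD Q hQm hQ _ _ _ (reindex_torusElt F E c hcδ hδ v a b) χv s _ (det_diagTwo F E v a b)]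
  congr 3
  exact Finset.prod_congr rfl fun w _ => by rw [← det_diagTwo, Units.val_mul]; rfl

end Summit.HodgeConjecture.HodgeConjecture.Cruxes.HLiu418.K2LiuDoubledUTwoTwoLeviTransport

end
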